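import Mathlib
import Summits.QuantumFields.QCD.Theses.PauliWegnerSea
import Literature.MathematicalPhysics.QuantumFieldTheory.QCDHeavyQuarkPropagator
import Literature.MathematicalPhysics.QuantumFieldTheory.QCDWickMinorMeasurability
import Literature.MathematicalPhysics.QuantumFieldTheory.QCDPhaseQuenchedPositivity

/-!
# The crux from its reg-free uniform pencil form

Crux `stmt-QuantumFields-9151` (`PhaseQuenchedFlavourDecay`), line crossing-split-integrability.
Pure bookkeeping: the reg-free UNIFORM pencil form of the crux — Fredenhagen–Marcu data `(s, C)`
determine one rate factor `θ > 0`, and for every flavour-charged pair `(A, B)` an amplitude `Φ`, a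
rate ceiling `μ₀ > 0` and a volume floor `Λ₀` such that at every lattice parameter point
`(β, c + λ m)` of the pencil (`λ > 0`), every rate `0 < μ ≤ μ₀` and every `L` with `Λ₀ ≤ μ L`,
fractional-moment decay `FM ≤ C e^{-μ |v|}` on the volumes `S ≥ L` forces clustering
`|⟨A(0) B(n e₀)⟩| ≤ Φ e^{-θ μ n}` on those volumes — implies the crux along any
`QCDRegularisation`, by specialising to the bare trajectory
`mq_k = m_crit(k) + a_k m / Z_m(k) = m_crit(k) + (a_k / Z_m(k)) m` (a pencil point with
`λ = a_k / Z_m(k) > 0`), rate `μ_k = δ a_k → 0` and `μ_k L_k = δ (a_k L_k) → ∞`; the crux's rate is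
`δ' = θ δ`.
-/

noncomputable section

namespace Summit.QuantumFields.QCD.Cruxes.PhaseQuenchedFlavourDecay.CrossingSplitIntegrability

open scoped BigOperators
open MeasureTheory Filter
open Literature.MathematicalPhysics.QuantumFieldTheory Literature.MathematicalPhysics.QuantumLattice
  Literature.Probability.LatticeModels

/-- The bare mass tuple at step `k` is the pencil point `c + λ m` with `c = m_crit(k)`,
`λ = a_k / Z_m(k)`. -/
private theorem mq_pencil_eq {Nf : ℕ} (reg : QCDRegularisation Nf) (m : Fin Nf → ℝ) (k : ℕ) :
    (fun fl => reg.mcrit k + reg.a k * m fl / reg.Zm k) =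
      fun fl => reg.mcrit k + reg.a k / reg.Zm k * m fl := by
  funext fl
  rw [mul_div_right_comm]

/-- Abstract form of `stub_crux_of_uniformPencil`, over opaque families: `ΨU β c lam s S f v`
(fractional moments at the pencil point `(β, c + λ m)`), `ΞU β c lam R R' A B S n` (correlations
there), their values `Ψk`, `Ξk` along the bare trajectory of `reg`, and a charge predicate `P`.
Eventually in `k` the rate `δ a_k` is below `μ₀` (`a_k → 0`) and `Λ₀ ≤ δ a_k L_k` (`a_k L_k → ∞`),
so the uniform implication applies at every late step with rate `μ = δ a_k`, giving decay at rate
`θ δ a_k` with the `k`-independent amplitude `Φ`. -/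
private theorem crux_core {Nf : ℕ} (reg : QCDRegularisation Nf)
    (P : ∀ R : ℕ, QCDLatticeObservable Nf R → Prop)
    (ΨU : ℝ → ℝ → ℝ → ℝ → ℕ → Fin Nf → Literature.Probability.LatticeModels.Site 4 → ℝ)
    (Ψk : ℕ → ℝ → ℕ → Fin Nf → Literature.Probability.LatticeModels.Site 4 → ℝ)
    (ΞU : ℝ → ℝ → ℝ → ∀ R R' : ℕ, QCDLatticeObservable Nf R → QCDLatticeObservable Nf R' → ℕ → ℕ → ℂ)
    (Ξk : ℕ → ∀ R R' : ℕ, QCDLatticeObservable Nf R → QCDLatticeObservable Nf R' → ℕ → ℕ → ℂ)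
    (hΨ : ∀ k s S f v, Ψk k s S f v = ΨU (reg.β k) (reg.mcrit k) (reg.a k / reg.Zm k) s S f v)
    (hΞ : ∀ k R R' A B S n,
      Ξk k R R' A B S n = ΞU (reg.β k) (reg.mcrit k) (reg.a k / reg.Zm k) R R' A B S n)
    (hU : ∀ (s C : ℝ), 0 < s → s < 1 → ∃ θ : ℝ, 0 < θ ∧
      ∀ (R R' : ℕ) (A : QCDLatticeObservable Nf R) (B : QCDLatticeObservable Nf R'), P R A →
        ∃ Φ μ₀ Λ₀ : ℝ, 0 < μ₀ ∧ ∀ (β c lam μ : ℝ) (L : ℕ), 0 < lam → 0 < μ → μ ≤ μ₀ →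
          Λ₀ ≤ μ * L →
          (∀ S : ℕ, L ≤ S → ∀ (f : Fin Nf) (v : Literature.Probability.LatticeModels.Site 4),
            v ∈ box 4 S → ΨU β c lam s S f v ≤ C * Real.exp (-(μ * ‖v‖))) →
          ∀ S : ℕ, L ≤ S → ∀ n : ℕ, n ≤ S →
            ‖ΞU β c lam R R' A B S n‖ ≤ Φ * Real.exp (-(θ * μ * n)))
    (hUp : ∃ s δ C : ℝ, 0 < s ∧ s < 1 ∧ 0 < δ ∧ ∀ᶠ k in atTop, ∀ S : ℕ, reg.L k ≤ S →
      ∀ (f : Fin Nf) (v : Literature.Probability.LatticeModels.Site 4), v ∈ box 4 S →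
        Ψk k s S f v ≤ C * Real.exp (-(δ * (reg.a k * ‖v‖)))) :
    ∃ δ' : ℝ, 0 < δ' ∧
      ∀ (R R' : ℕ) (A : QCDLatticeObservable Nf R) (B : QCDLatticeObservable Nf R'), P R A →
        ∃ C' : ℝ, ∀ᶠ k in atTop, ∀ S : ℕ, reg.L k ≤ S → ∀ n : ℕ, n ≤ S →
          ‖Ξk k R R' A B S n‖ ≤ C' * Real.exp (-(δ' * (reg.a k * n))) := by
  obtain ⟨s, δ, C, hs, hs1, hδ, hev⟩ := hUp
  obtain ⟨θ, hθ, hAB⟩ := hU s C hs hs1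
  refine ⟨θ * δ, mul_pos hθ hδ, fun R R' A B hA => ?_⟩
  obtain ⟨Φ, μ₀, Λ₀, hμ₀, hmain⟩ := hAB R R' A B hA
  refine ⟨Φ, ?_⟩
  -- (i) the rate `δ * a k` is eventually below `μ₀` since `a k → 0`
  have h1 : ∀ᶠ k in atTop, δ * reg.a k ≤ μ₀ := by
    have h : Tendsto (fun k => δ * reg.a k) atTop (nhds (δ * 0)) := reg.tendsto_a.const_mul δ
    rw [mul_zero] at h
    exact h.eventually_le_const hμ₀
  -- (ii) `Λ₀ ≤ (δ * a k) * L k` eventually since `a k * L k → ∞`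
  have h2 : ∀ᶠ k in atTop, Λ₀ ≤ δ * reg.a k * (reg.L k : ℝ) := by
    have h : Tendsto (fun k => δ * (reg.a k * reg.L k)) atTop atTop :=
      reg.tendsto_L.const_mul_atTop hδ
    filter_upwards [h.eventually_ge_atTop Λ₀] with k hk
    rw [mul_assoc]
    exact hk
  filter_upwards [h1, h2, hev] with k hk1 hk2 hk3 S hS n hn
  have e : θ * δ * (reg.a k * n) = θ * (δ * reg.a k) * n := by ring
  rw [hΞ, e]
  exact hmain (reg.β k) (reg.mcrit k) (reg.a k / reg.Zm k) (δ * reg.a k) (reg.L k)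
    (div_pos (reg.a_pos k) (reg.Zm_pos k)) (mul_pos hδ (reg.a_pos k)) hk1 hk2
    (fun S' hS' f v hv => by
      rw [← hΨ, mul_assoc]
      exact hk3 S' hS' f v hv)
    S hS n hn

/-- W6 (bookkeeping): the reg-free UNIFORM pencil form of the crux implies the crux. Along a
regularisation `reg` the bare masses at step `k` form the pencil point `c + λ m` with
`c = m_crit(k)`, `λ = a_k / Z_m(k) > 0` (`mq_pencil_eq`); with UPPER-data `(s, δ, C)` the uniform
form supplies `θ` and, per charged pair, `(Φ, μ₀, Λ₀)`; eventually `δ a_k ≤ μ₀` and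
`Λ₀ ≤ δ a_k L_k`, so CONC holds with rate `δ' = θ δ` and amplitude `C' = Φ` (`crux_core`). -/
theorem stub_crux_of_uniformPencil :
    (∀ (Nf : ℕ) (m : Fin Nf → ℝ), (∀ f, 0 < m f) → ∀ (s C : ℝ), 0 < s → s < 1 → ∃ θ : ℝ, 0 < θ ∧ ∀ (R R' : ℕ) (A : QCDLatticeObservable Nf R) (B : QCDLatticeObservable Nf R'), (∃ (f₀ : Fin Nf) (q : ℤ), q ≠ 0 ∧ ∀ (θ : ℝ) (U : LGConfig 4 (Matrix.specialUnitaryGroup (Fin 3) ℂ)), ExteriorAlgebra.map (LinearMap.pi fun w => (Sum.elim (fun i => if (boxQuarkEquiv.symm i).1 = f₀ then Complex.exp (-((θ : ℂ) * Complex.I)) else 1) (fun i => if (boxQuarkEquiv.symm i).1 = f₀ then Complex.exp ((θ : ℂ) * Complex.I) else 1) (ofLex w)) • LinearMap.proj w) (A.F U) = Complex.exp (((q : ℝ) * θ : ℝ) * Complex.I) • A.F U) → ∃ Φ μ₀ Λ₀ : ℝ, 0 < μ₀ ∧ ∀ (β c lam μ : ℝ) (L : ℕ), 0 < lam → 0 <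 μ → μ ≤ μ₀ → Λ₀ ≤ μ * L → (∀ S : ℕ, L ≤ S → ∀ (f : Fin Nf) (v : Literature.Probability.LatticeModels.Site 4), v ∈ box 4 S → (∫ U : GaugeConfig 4 (2 * S + 1) (Matrix.specialUnitaryGroup (Fin 3) ℂ), ‖(diracMatrix U fun fl => c + lam * m fl).det‖ * (∑ a : Fin 3, ∑ i : Fin 4, ∑ b : Fin 3, ∑ j : Fin 4, ‖(diracMatrix U fun fl => c + lam * m fl)⁻¹ (quarkEquiv (f, (Torus.proj (2 * S + 1) 0, a, i))) (quarkEquiv (f, (Torus.proj (2 * S + 1) (v), b, j)))‖) ^ s ∂(wilsonMeasure (fundamentalRep (Fin 3)) β)) / (∫ U : GaugeConfig 4 (2 * S + 1) (Matrix.specialUnitaryGroup (Fin 3) ℂ), ‖(diracMatrix U fun fl => c + lam * m fl).det‖ ∂(wilsonMeasure (fundamentalRep (Fin 3)) β)) ≤ C * Real.exp (-(μ * ‖v‖))) → ∀ S : ℕ, L ≤ S → ∀ n : ℕ, n ≤ S → ‖(∫ U : GaugeConfig 4 (2 * S + 1) (Matrix.specialUnitaryGroup (Fin 3) ℂ), (‖(diracMatrix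 U fun fl => c + lam * m fl).det‖ : ℂ) * (fermiIntegral (A.onTorus (2 * S + 1) 0 U * B.onTorus (2 * S + 1) (Pi.single 0 (n : ℤ)) U * fermiBoltzmann U fun fl => c + lam * m fl) / fermiIntegral (fermiBoltzmann U fun fl => c + lam * m fl)) ∂(wilsonMeasure (fundamentalRep (Fin 3)) β)) / (∫ U : GaugeConfig 4 (2 * S + 1) (Matrix.specialUnitaryGroup (Fin 3) ℂ), (‖(diracMatrix U fun fl => c + lam * m fl).det‖ : ℂ) ∂(wilsonMeasure (fundamentalRep (Fin 3)) β))‖ ≤ Φ * Real.exp (-(θ * μ * n))) → Summit.QuantumFields.QCD.Theses.PauliWegnerSea.PhaseQuenchedFlavourDecay := by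
  intro hU Nf reg m hm hUp
  refine crux_core reg _ _ _ _ _ (fun k s S f v => ?_) (fun k R R' A B S n => ?_) (hU Nf m hm) hUp
  · rw [mq_pencil_eq reg m k]
  · rw [mq_pencil_eq reg m k]

end Summit.QuantumFields.QCD.Cruxes.PhaseQuenchedFlavourDecay.CrossingSplitIntegrability
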